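import Mathlib.Analysis.SpecialFunctions.Pow.Real
import Literature.NumberTheory.LFunctions.BettinConreyFarmer2013
import Literature.NumberTheory.LFunctions.ZetaZerosProofs
import Literature.NumberTheory.LFunctions.RHWave0
import HarnessLib

/-!
# Bettin–Conrey–Farmer 2013, condition (2): the logical status of `BettinConreyFarmer2013_hyp`

Companion of `BettinConreyFarmer2013.lean` (topic `Literature/NumberTheory/LFunctions`). Everything
in this file is PROVED; there are no definitions and no named facts.

`Literature.NumberTheory.LFunctions.BettinConreyFarmer2013_hyp` is the *hypothesis* (2) of
[BettinConreyFarmer2013, Thm. 1] — "If the Riemann hypothesis is true and if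
`Σ_{|Im ρ| ≤ T} 1/|ζ'(ρ)|² ≪ T^{3/2-δ}` for some `δ > 0`, then …" — vendored as the conjunction of
(i) the simplicity of all non-trivial zeros ("The condition (2) implicitly assumes that the zeros
of the Riemann zeta function are all simple", p. 3 of the arXiv version) and (ii) the power-saving
bound for the negative second discrete moment `Σ_{0 < Im ρ ≤ T} |ζ'(ρ)|⁻²` over the boxes
`zetaZeroBox 0 T`, one constant for all `T ≥ 2`. The paper proves nothing about (2); it calls it
"mild" because "a conjecture, due to Gonek and recovered by a different heuristic method of Hughes,
Keating, and O'Connell [HKO], predicts that `Σ_{|ρ| ≤ T} 1/|ζ'(ρ)|² ∼ (6/π³) T`" (p. 3;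
[Gonek1989], [HughesKeatingOconnell2001]).

What this file records, kernel-checked:

* `BettinConreyFarmer2013_hyp_simple_iff` — conjunct (i) is *verbatim* the Simple Zeros
  Conjecture `Literature.NumberTheory.LFunctions.SimpleZerosConjecture` (statement rh.S17 of
  `RHWave0.lean`), transported along
  `Literature.NumberTheory.LFunctions.mem_riemannZetaNontrivialZeros_iff_holds` (the non-trivial
  zeros are exactly the zeros with `0 < Re ρ < 1`);
* `BettinConreyFarmer2013_hyp_iff`, `BettinConreyFarmer2013_hyp.simpleZerosConjecture` — hence
  `BettinConreyFarmer2013_hyp → SimpleZerosConjecture`: a discharge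
  `BettinConreyFarmer2013_hyp_holds` would in particular settle the Simple Zeros Conjecture, which
  is open. Conjunct (ii) is open as well, even under RH and (i): "No upper bounds are known for
  `J_{-k}(T)` in the case when `k > 0`" and, over the full family of zeros, "it seems that simply
  assuming RH and the simplicity of zeros is not enough" [BuiFloreaMilinovich2023, §1.1 and §1.2]
  (only lower bounds `J_{-1}(T) ≫ T` are known, [Gonek1989], under RH). Consequently the tree has
  no `BettinConreyFarmer2013_hyp_holds`; `BettinConreyFarmer2013_hyp` is used only as a hypothesis
  (by `BettinConreyFarmer2013_thm1` and its proof files `BettinConreyFarmer2013Zeros.lean`, …).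
* `exists_forall_ge_two_iff_eventually`, `BettinConreyFarmer2013_hyp_iff_eventually` — the
  vendored reading of "`≪`" in (2) as ONE constant for all `T ≥ 2` is equivalent to the literal
  reading "for all sufficiently large `T`", because the partial sums are non-decreasing in `T`
  (`BettinConreyFarmer2013_hyp_sum_mono`) and `T^{3/2-δ}` is bounded below on compact subintervals
  of `[2, ∞)`; this justifies the design note in the docstring of `BettinConreyFarmer2013_hyp`.

## References

* S. Bettin, J. B. Conrey, D. W. Farmer, *An optimal choice of Dirichlet polynomials for the
  Nyman–Beurling criterion*, Proc. Steklov Inst. Math. 280 (2013), suppl. 2, S30–S36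
  = arXiv:1211.5191, §1, Theorem 1 and the paragraph after it. [BettinConreyFarmer2013]
* H. M. Bui, A. Florea, M. B. Milinovich, *Negative discrete moments of the derivative of the
  Riemann zeta-function*, Bull. Lond. Math. Soc. 56 (2024) = arXiv:2310.03949, §1.1–1.2.
  [BuiFloreaMilinovich2023]
* S. M. Gonek, *On negative moments of the Riemann zeta-function*, Mathematika 36 (1989), 71–88.
  [Gonek1989]
* C. P. Hughes, J. P. Keating, N. O'Connell, *Random matrix theory and the derivative of the
  Riemann zeta function*, Proc. R. Soc. A 456 (2000); Comm. Math. Phys. 220 (2001).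
  [HughesKeatingOconnell2001]
-/

noncomputable section

open Filter

namespace Literature.NumberTheory.LFunctions

/-! ### Conjunct (i) is the Simple Zeros Conjecture -/

/-- The simplicity clause of `BettinConreyFarmer2013_hyp` — `ζ'(ρ) ≠ 0` at every zero with
`0 < Re ρ < 1` — is equivalent to `SimpleZerosConjecture` (`ζ'(ρ) ≠ 0` at every non-trivial zero,
i.e. every zero other than `-2(n+1)`), because the non-trivial zeros are exactly the zeros in the
open critical strip (`mem_riemannZetaNontrivialZeros_iff_holds`; the sets
`RHWave0.riemannZetaNontrivialZeros` and `ZetaZeros.riemannZetaNontrivialZeros` agree by `rfl`).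
[folklore] -/
theorem BettinConreyFarmer2013_hyp_simple_iff :
    (∀ ρ : ℂ, riemannZeta ρ = 0 → 0 < ρ.re → ρ.re < 1 → deriv riemannZeta ρ ≠ 0) ↔
      SimpleZerosConjecture := by
  constructor
  · intro h ρ hρ
    have h' : riemannZeta ρ = 0 ∧ 0 < ρ.re ∧ ρ.re < 1 :=
      mem_riemannZetaNontrivialZeros_iff_holds.1 (show ρ ∈ ZetaZeros.riemannZetaNontrivialZeros from hρ)
    exact h ρ h'.1 h'.2.1 h'.2.2
  · intro h ρ h0 h1 h2
    exact h ρ (show ρ ∈ ZetaZeros.riemannZetaNontrivialZeros from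
      mem_riemannZetaNontrivialZeros_iff_holds.2 ⟨h0, h1, h2⟩)

/-- `BettinConreyFarmer2013_hyp` unfolded with its first conjunct identified as the Simple Zeros
Conjecture: (2) of the paper, as vendored, is `SimpleZerosConjecture ∧` (the power-saving bound
`Σ_{ρ ∈ zetaZeroBox 0 T} |ζ'(ρ)|⁻² ≤ C T^{3/2-δ}` for some `δ > 0`, `C`, and all `T ≥ 2`).
[cite: BettinConreyFarmer2013, Thm. 1, condition (2) and p. 3] -/
theorem BettinConreyFarmer2013_hyp_iff :
    BettinConreyFarmer2013_hyp ↔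
      SimpleZerosConjecture ∧
        ∃ δ : ℝ, 0 < δ ∧ ∃ C : ℝ, ∀ T : ℝ, 2 ≤ T →
          ∑ᶠ ρ ∈ zetaZeroBox 0 T, 1 / ‖deriv riemannZeta ρ‖ ^ 2 ≤ C * T ^ (3 / 2 - δ) :=
  and_congr_left' BettinConreyFarmer2013_hyp_simple_iff

/-- **`BettinConreyFarmer2013_hyp` implies the Simple Zeros Conjecture.** In particular a proof
of `BettinConreyFarmer2013_hyp` (a `BettinConreyFarmer2013_hyp_holds`) would settle an open
problem; the fact is hypothesis vocabulary for `BettinConreyFarmer2013_thm1`, not a published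
theorem. [cite: BettinConreyFarmer2013, p. 3 ("(2) implicitly assumes that the zeros … are all simple")] -/
theorem BettinConreyFarmer2013_hyp.simpleZerosConjecture (h : BettinConreyFarmer2013_hyp) :
    SimpleZerosConjecture :=
  BettinConreyFarmer2013_hyp_simple_iff.1 h.1

/-- Conversely, the Simple Zeros Conjecture supplies the simplicity clause, so that under it
`BettinConreyFarmer2013_hyp` reduces to the moment bound alone. [folklore] -/
theorem BettinConreyFarmer2013_hyp_of_simpleZerosConjecture (hS : SimpleZerosConjecture)
    (hB : ∃ δ : ℝ, 0 < δ ∧ ∃ C : ℝ, ∀ T : ℝ, 2 ≤ T →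
      ∑ᶠ ρ ∈ zetaZeroBox 0 T, 1 / ‖deriv riemannZeta ρ‖ ^ 2 ≤ C * T ^ (3 / 2 - δ)) :
    BettinConreyFarmer2013_hyp :=
  BettinConreyFarmer2013_hyp_iff.2 ⟨hS, hB⟩

/-! ### "`≪` for all `T ≥ 2`" versus "`≪` for all large `T`" -/

/-- The partial sums `T ↦ Σ_{ρ ∈ zetaZeroBox 0 T} |ζ'(ρ)|⁻²` of condition (2) are non-decreasing
in `T` (finite sums of non-negative terms over the increasing finite sets `zetaZeroBox 0 T`).
[folklore] -/
theorem BettinConreyFarmer2013_hyp_sum_mono :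
    Monotone fun T : ℝ ↦ ∑ᶠ ρ ∈ zetaZeroBox 0 T, 1 / ‖deriv riemannZeta ρ‖ ^ 2 := by
  intro T T' h
  simp only
  rw [finsum_mem_eq_finite_toFinset_sum _ (zetaZeroBox_finite 0 T),
    finsum_mem_eq_finite_toFinset_sum _ (zetaZeroBox_finite 0 T')]
  refine Finset.sum_le_sum_of_subset_of_nonneg (fun ρ hρ ↦ ?_) fun ρ _ _ ↦ by positivity
  rw [Set.Finite.mem_toFinset] at hρ ⊢
  -- `zetaZeroBox 0 T ⊆ zetaZeroBox 0 T'` (as `Montgomery.zetaZeroBox_mono` in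
  -- `ZetaZeroBoxEnumeration.lean`, inlined to keep the imports light)
  exact ⟨hρ.1, hρ.2.1, hρ.2.2.1, hρ.2.2.2.1, hρ.2.2.2.2.trans h⟩

/-- The partial sums of condition (2) are non-negative. [folklore] -/
theorem BettinConreyFarmer2013_hyp_sum_nonneg (T : ℝ) :
    0 ≤ ∑ᶠ ρ ∈ zetaZeroBox 0 T, 1 / ‖deriv riemannZeta ρ‖ ^ 2 :=
  finsum_nonneg fun _ ↦ finsum_nonneg fun _ ↦ by positivity

/-- For a non-decreasing `S : ℝ → ℝ` and any real exponent `e`, a bound `S(T) ≤ C T^e` with ONE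
constant for all `T ≥ 2` is equivalent to such a bound for all sufficiently large `T` (with a
possibly larger constant): on a compact interval `[2, T₀]`, `S ≤ max (S T₀) 0` while `T^e` is
bounded below by `min (2^e) (T₀^e) > 0`. [folklore] -/
theorem exists_forall_ge_two_iff_eventually {S : ℝ → ℝ} (hS : Monotone S) (e : ℝ) :
    (∃ C : ℝ, ∀ T : ℝ, 2 ≤ T → S T ≤ C * T ^ e) ↔ ∃ C : ℝ, ∀ᶠ T : ℝ in atTop, S T ≤ C * T ^ e := by
  constructor
  · rintro ⟨C, hC⟩
    exact ⟨C, (eventually_ge_atTop 2).mono hC⟩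
  · rintro ⟨C, hC⟩
    obtain ⟨T₀, hT₀⟩ := eventually_atTop.1 hC
    -- enlarge `T₀` to `T₁ ≥ 2`
    set T₁ : ℝ := max T₀ 2
    have hT₁2 : 2 ≤ T₁ := le_max_right _ _
    have hT₁pos : 0 < T₁ := lt_of_lt_of_le two_pos hT₁2
    have hlarge : ∀ T, T₁ ≤ T → S T ≤ C * T ^ e := fun T hT ↦ hT₀ T ((le_max_left _ _).trans hT)
    -- a positive lower bound for `T ^ e` on `[2, T₁]`
    set m : ℝ := min ((2 : ℝ) ^ e) (T₁ ^ e)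
    have hmpos : 0 < m := lt_min (Real.rpow_pos_of_pos two_pos e) (Real.rpow_pos_of_pos hT₁pos e)
    have hm : ∀ T, 2 ≤ T → T ≤ T₁ → m ≤ T ^ e := by
      intro T h2 hT
      rcases le_total 0 e with he | he
      · exact (min_le_left _ _).trans (Real.rpow_le_rpow (by norm_num) h2 he)
      · exact (min_le_right _ _).trans
          (Real.rpow_le_rpow_of_nonpos (lt_of_lt_of_le two_pos h2) hT he)
    -- the constant
    set M : ℝ := max (S T₁) 0
    have hM0 : 0 ≤ M := le_max_right _ _
    refine ⟨max C (M / m), fun T h2 ↦ ?_⟩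
    have hTpos : 0 < T := lt_of_lt_of_le two_pos h2
    have hTe : 0 < T ^ e := Real.rpow_pos_of_pos hTpos e
    rcases le_total T₁ T with hT | hT
    · calc S T ≤ C * T ^ e := hlarge T hT
        _ ≤ max C (M / m) * T ^ e := by gcongr; exact le_max_left _ _
    · calc S T ≤ S T₁ := hS hT
        _ ≤ M := le_max_left _ _
        _ = M / m * m := by field_simp
        _ ≤ M / m * T ^ e := by gcongr; exact hm T h2 hT
        _ ≤ max C (M / m) * T ^ e := by gcongr; exact le_max_right _ _

/-- `BettinConreyFarmer2013_hyp` with "`≪`" read literally as "for all sufficiently large `T`":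
the vendored form (one constant for all `T ≥ 2`) is equivalent to it, by
`exists_forall_ge_two_iff_eventually` applied to the non-decreasing partial sums
(`BettinConreyFarmer2013_hyp_sum_mono`). [cite: BettinConreyFarmer2013, Thm. 1, condition (2)] -/
theorem BettinConreyFarmer2013_hyp_iff_eventually :
    BettinConreyFarmer2013_hyp ↔
      SimpleZerosConjecture ∧
        ∃ δ : ℝ, 0 < δ ∧ ∃ C : ℝ, ∀ᶠ T : ℝ in atTop,
          ∑ᶠ ρ ∈ zetaZeroBox 0 T, 1 / ‖deriv riemannZeta ρ‖ ^ 2 ≤ C * T ^ (3 / 2 - δ) := by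
  refine BettinConreyFarmer2013_hyp_iff.trans (and_congr_right' (exists_congr fun δ ↦ ?_))
  exact and_congr_right' (exists_forall_ge_two_iff_eventually BettinConreyFarmer2013_hyp_sum_mono _)

end Literature.NumberTheory.LFunctions

end
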